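import Mathlib
import Summits.ValiantsHypothesis.ValiantsHypothesis.Theorems.ValuativeGCTValuativeFlipContinuant

/-!
# The tridiagonal Toeplitz pencil: `adj(T) · T`, `det T` and Usmani's adjugate formula

Crux `ValuativeGCT.ValuativeFlip` (stmt-ValiantsHypothesis-12624), wall-breaker axis 14
("plethysm tables, small cases certified"), gen 1: row 3 of the few-row table
(ternary forms are border-determinantal), file 2 of 5 (over `…Continuant`).

`T = triT n` is the `(n+1) × (n+1)` matrix over `ℂ[x, y, z]` with `x` on the diagonal, `y` on the
superdiagonal and `z` on the subdiagonal.  We write down the candidate adjugate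
`adjT n = (adjC n i j)`, `adjC n i j = (-y)^{j-i} θ_i θ_{n-j}` (`i ≤ j`), `(-z)^{i-j} θ_j θ_{n-i}`
(`i > j`) (Usmani's formula for the inverse of a tridiagonal matrix, cleared of denominators),
verify `adjT · T = θ_{n+1} · 1` row by row from the continuant recursion and the addition formula
(`adjT_mul_triT`), read off `det T = θ_{n+1}` from the corner cofactor (a triangular minor,
`det_triT`) and conclude `adj(T) = adjT` by cancelling the non-zero-divisor `θ_{n+1}`
(`adjugate_triT`, registered stub).  The next file shows that these cofactors span all ternary
forms of degree `n`.

References: R. A. Usmani, *Inversion of a tridiagonal Jacobi matrix*, Linear Algebra Appl.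
212/213 (1994) 413–414; classical continuants.  Mathlib: `Matrix.adjugate_fin_succ_eq_det_submatrix`,
`Matrix.det_of_lowerTriangular`, `Matrix.mul_adjugate`.
-/

set_option linter.dupNamespace false

namespace Summit.ValiantsHypothesis.ValiantsHypothesis.Theorems.ValuativeFlip

open MvPolynomial
open scoped BigOperators Matrix

noncomputable section

/-! ## The tridiagonal Toeplitz pencil and its candidate adjugate -/

/-- The tridiagonal Toeplitz pencil `T = x·1 + y·N + z·Nᵀ` of size `n + 1` over `ℂ[x, y, z]`:
`x` on the diagonal, `y` on the superdiagonal, `z` on the subdiagonal. [classical] -/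
def triT (n : ℕ) : Matrix (Fin (n + 1)) (Fin (n + 1)) (MvPolynomial (Fin 3) ℂ) :=
  Matrix.of fun i j => if (j : ℕ) = i then X 0 else if (j : ℕ) = i + 1 then X 1
    else if (i : ℕ) = j + 1 then X 2 else 0

/-- The superdiagonal shift matrix `N`, `N i (i+1) = 1`. [classical] -/
def supN (n : ℕ) : Matrix (Fin (n + 1)) (Fin (n + 1)) (MvPolynomial (Fin 3) ℂ) :=
  Matrix.of fun i j => if (j : ℕ) = i + 1 then 1 else 0

/-- `T = x·1 + y·N + z·Nᵀ`. [classical] -/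
theorem triT_eq (n : ℕ) :
    triT n = (X 0 : MvPolynomial (Fin 3) ℂ) • (1 : Matrix (Fin (n + 1)) (Fin (n + 1)) (MvPolynomial (Fin 3) ℂ)) +
      (X 1 : MvPolynomial (Fin 3) ℂ) • supN n + (X 2 : MvPolynomial (Fin 3) ℂ) • (supN n)ᵀ := by
  apply Matrix.ext
  intro i j
  simp only [triT, supN, Matrix.of_apply, Matrix.add_apply, Matrix.smul_apply,
    Matrix.one_apply, Matrix.transpose_apply, smul_eq_mul, mul_ite, mul_one, mul_zero]
  by_cases h1 : (j : ℕ) = i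
  · have hij : i = j := Fin.ext h1.symm
    have h2 : ¬ ((j : ℕ) = i + 1) := by omega
    have h3 : ¬ ((i : ℕ) = j + 1) := by omega
    rw [if_pos h1, if_pos hij, if_neg h2, if_neg h3, add_zero, add_zero]
  · have hij : ¬ (i = j) := fun h => h1 (congrArg Fin.val h).symm
    by_cases h2 : (j : ℕ) = i + 1
    · have h3 : ¬ ((i : ℕ) = j + 1) := by omega
      rw [if_neg h1, if_neg hij, if_pos h2, if_pos h2, if_neg h3, zero_add, add_zero]
    · by_cases h3 : (i : ℕ) = j + 1
      · rw [if_neg h1, if_neg hij, if_neg h2, if_neg h2, if_pos h3, zero_add, zero_add]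
      · rw [if_neg h1, if_neg hij, if_neg h2, if_neg h2, if_neg h3, zero_add, zero_add]

/-- Right multiplication by the superdiagonal shift moves columns right:
`(B N) i j = B i (j-1)` (`0` in column `0`). [folklore] -/
theorem mul_supN_apply {n : ℕ} (B : Matrix (Fin (n + 1)) (Fin (n + 1)) (MvPolynomial (Fin 3) ℂ))
    (i j : Fin (n + 1)) :
    (B * supN n) i j = if h : (j : ℕ) = 0 then 0 else B i ⟨(j : ℕ) - 1, by omega⟩ := by
  rw [Matrix.mul_apply]
  split_ifs with h
  · refine Finset.sum_eq_zero fun k _ => ?_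
    simp [supN, h]
  · rw [Finset.sum_eq_single ⟨(j : ℕ) - 1, by omega⟩]
    · have : ((j : ℕ) = (j : ℕ) - 1 + 1) := by omega
      simp [supN, this.symm]
    · intro k _ hk
      have hk' : ¬ ((j : ℕ) = k + 1) := by
        intro hjk; apply hk; ext; simp; omega
      simp [supN, hk']
    · intro h; exact absurd (Finset.mem_univ _) h

/-- Right multiplication by the subdiagonal shift moves columns left:
`(B Nᵀ) i j = B i (j+1)` (`0` in the last column). [folklore] -/
theorem mul_supN_transpose_apply {n : ℕ}
    (B : Matrix (Fin (n + 1)) (Fin (n + 1)) (MvPolynomial (Fin 3) ℂ)) (i j : Fin (n + 1)) :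
    (B * (supN n)ᵀ) i j = if h : (j : ℕ) + 1 < n + 1 then B i ⟨(j : ℕ) + 1, h⟩ else 0 := by
  rw [Matrix.mul_apply]
  split_ifs with h
  · rw [Finset.sum_eq_single ⟨(j : ℕ) + 1, h⟩]
    · simp [supN]
    · intro k _ hk
      have hk' : ¬ ((k : ℕ) = j + 1) := by
        intro hjk; apply hk; ext; simp; omega
      simp [supN, Matrix.transpose_apply, hk']
    · intro h; exact absurd (Finset.mem_univ _) h
  · refine Finset.sum_eq_zero fun k _ => ?_
    have hk' : ¬ ((k : ℕ) = j + 1) := by have := k.2; omega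
    simp [supN, Matrix.transpose_apply, hk']

/-- The candidate adjugate, as a function of natural indices (Usmani's formula for the
tridiagonal Toeplitz matrix): `a(i, j) = (-y)^{j-i} θ_i θ_{n-j}` for `i ≤ j` and
`(-z)^{i-j} θ_j θ_{n-i}` for `i > j`. [folklore; Usmani, LAA 212/213 (1994)] -/
def adjC (n i j : ℕ) : MvPolynomial (Fin 3) ℂ :=
  if i ≤ j then (-X 1) ^ (j - i) * tco i * tco (n - j)
  else (-X 2) ^ (i - j) * tco j * tco (n - i)

/-- Value above / on the diagonal. [this file] -/
theorem adjC_of_le {n i j : ℕ} (h : i ≤ j) :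
    adjC n i j = (-X 1) ^ (j - i) * tco i * tco (n - j) := if_pos h

/-- Value below the diagonal. [this file] -/
theorem adjC_of_lt {n i j : ℕ} (h : j < i) :
    adjC n i j = (-X 2) ^ (i - j) * tco j * tco (n - i) := if_neg (by omega)

/-- The candidate adjugate matrix of `triT n`. [this file] -/
def adjT (n : ℕ) : Matrix (Fin (n + 1)) (Fin (n + 1)) (MvPolynomial (Fin 3) ℂ) :=
  Matrix.of fun i j => adjC n i j

/-- Row identity above the diagonal (`i < j ≤ n`): `x a(i,j) + y a(i,j-1) + z a(i,j+1) = 0`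
(the last term only when `j < n`) — the continuant recursion. [this file] -/
theorem adjC_row_lt {n i j : ℕ} (hij : i < j) (hjn : j ≤ n) :
    X 0 * adjC n i j + X 1 * adjC n i (j - 1) +
      (if j + 1 ≤ n then X 2 * adjC n i (j + 1) else 0) = 0 := by
  obtain ⟨d, rfl⟩ : ∃ d, j = i + d + 1 := ⟨j - i - 1, by omega⟩
  obtain ⟨e, rfl⟩ : ∃ e, n = i + d + 1 + e := ⟨n - (i + d + 1), by omega⟩
  rw [adjC_of_le (by omega), adjC_of_le (by omega),
    show i + d + 1 - i = d + 1 by omega, show i + d + 1 + e - (i + d + 1) = e by omega,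
    show i + d + 1 - 1 - i = d by omega, show i + d + 1 + e - (i + d + 1 - 1) = e + 1 by omega]
  rcases e with _ | e
  · rw [if_neg (by omega), tco_one, tco_zero]
    ring
  · rw [if_pos (by omega), adjC_of_le (by omega), show i + d + 1 + 1 - i = d + 2 by omega,
      show i + d + 1 + (e + 1) - (i + d + 1 + 1) = e by omega,
      tco_rec (a := e) (b := e + 1) (c := e + 1 + 1) rfl rfl]
    ring

/-- Row identity below the diagonal (`j < i ≤ n`): `x a(i,j) + y a(i,j-1) + z a(i,j+1) = 0`
(the middle term only when `0 < j`). [this file] -/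
theorem adjC_row_gt {n i j : ℕ} (hij : j < i) (hin : i ≤ n) :
    X 0 * adjC n i j + (if j = 0 then 0 else X 1 * adjC n i (j - 1)) +
      X 2 * adjC n i (j + 1) = 0 := by
  obtain ⟨d, rfl⟩ : ∃ d, i = j + d + 1 := ⟨i - j - 1, by omega⟩
  obtain ⟨e, rfl⟩ : ∃ e, n = j + d + 1 + e := ⟨n - (j + d + 1), by omega⟩
  have hlast : adjC (j + d + 1 + e) (j + d + 1) (j + 1) = (-X 2) ^ d * tco (j + 1) * tco e := by
    rcases d with _ | d
    · rw [adjC_of_le (by omega), show j + 1 - (j + 0 + 1) = 0 by omega,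
        show j + 0 + 1 + e - (j + 1) = e by omega, show j + 0 + 1 = j + 1 by omega, pow_zero,
        pow_zero]
    · rw [adjC_of_lt (by omega), show j + (d + 1) + 1 - (j + 1) = d + 1 by omega,
        show j + (d + 1) + 1 + e - (j + (d + 1) + 1) = e by omega]
  rw [adjC_of_lt (by omega), show j + d + 1 - j = d + 1 by omega,
    show j + d + 1 + e - (j + d + 1) = e by omega, hlast]
  rcases j with _ | j
  · rw [if_pos rfl, tco_zero, show (0 : ℕ) + 1 = 1 from rfl, tco_one]
    ring
  · rw [if_neg (by omega), adjC_of_lt (by omega), show j + 1 - 1 = j by omega,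
      show j + 1 + d + 1 - j = d + 2 by omega, show j + 1 + d + 1 + e - (j + 1 + d + 1) = e by omega,
      tco_rec (a := j) (b := j + 1) (c := j + 1 + 1) rfl rfl]
    ring

/-- Diagonal identity (`i ≤ n`): `x a(i,i) + y a(i,i-1) + z a(i,i+1) = θ_{n+1}` — the addition
formula for continuants. [this file] -/
theorem adjC_row_eq {n i : ℕ} (hin : i ≤ n) :
    X 0 * adjC n i i + (if i = 0 then 0 else X 1 * adjC n i (i - 1)) +
      (if i + 1 ≤ n then X 2 * adjC n i (i + 1) else 0) = tco (n + 1) := by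
  obtain ⟨e, rfl⟩ : ∃ e, n = i + e := ⟨n - i, by omega⟩
  rw [adjC_of_le le_rfl, Nat.sub_self, show i + e - i = e by omega, pow_zero, one_mul]
  rcases i with _ | i
  · rw [if_pos rfl, tco_zero]
    rcases e with _ | e
    · rw [if_neg (by omega)]
      simp
    · rw [if_pos (by omega), adjC_of_le (by omega), show 0 + (e + 1) - (0 + 1) = e by omega,
        show 0 + 1 - 0 = 1 from rfl, tco_zero,
        tco_rec (a := e) (b := e + 1) (c := 0 + (e + 1) + 1) rfl (by omega)]
      ring
  · rw [if_neg (by omega), adjC_of_lt (by omega), show i + 1 - 1 = i by omega,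
      show i + 1 - i = 1 by omega, show i + 1 + e - (i + 1) = e by omega]
    rcases e with _ | e
    · rw [if_neg (by omega), tco_zero,
        tco_rec (a := i) (b := i + 1) (c := i + 1 + 0 + 1) rfl (by omega)]
      ring
    · rw [if_pos (by omega), adjC_of_le (by omega), show i + 1 + 1 - (i + 1) = 1 by omega,
        show i + 1 + (e + 1) - (i + 1 + 1) = e by omega,
        show i + 1 + (e + 1) + 1 = i + (e + 1) + 2 by omega, tco_add_add_two i (e + 1),
        tco_rec (a := e) (b := e + 1) (c := e + 1 + 1) rfl rfl]
      ring

/-- **`adjT · T = θ_{n+1} · 1`.** [folklore; Usmani, LAA 212/213 (1994)] -/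
theorem adjT_mul_triT (n : ℕ) :
    adjT n * triT n = tco (n + 1) • (1 : Matrix (Fin (n + 1)) (Fin (n + 1)) (MvPolynomial (Fin 3) ℂ)) := by
  rw [triT_eq, Matrix.mul_add, Matrix.mul_add, Matrix.mul_smul, Matrix.mul_smul, Matrix.mul_smul,
    Matrix.mul_one]
  apply Matrix.ext
  intro i j
  rw [Matrix.add_apply, Matrix.add_apply, Matrix.smul_apply, Matrix.smul_apply, Matrix.smul_apply,
    mul_supN_apply, mul_supN_transpose_apply, Matrix.smul_apply, Matrix.one_apply]
  simp only [adjT, Matrix.of_apply, smul_eq_mul, mul_ite, mul_one, mul_zero]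
  have hi := i.2
  have hj := j.2
  rcases lt_trichotomy (i : ℕ) j with hlt | heq | hgt
  · have hne : i ≠ j := fun h => by simp [h] at hlt
    rw [if_neg hne, dif_neg (by omega)]
    have h := adjC_row_lt (n := n) hlt (by omega)
    by_cases hj1 : (j : ℕ) + 1 < n + 1
    · rw [dif_pos hj1, if_pos (by omega)] at *
      simpa [mul_assoc] using h
    · rw [dif_neg hj1]
      rw [if_neg (by omega)] at h
      simpa using h
  · have hij : i = j := Fin.ext heq
    subst hij
    rw [if_pos rfl]
    have h := adjC_row_eq (n := n) (i := i) (by omega)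
    by_cases hi0 : (i : ℕ) = 0
    · rw [dif_pos hi0]
      rw [if_pos hi0] at h
      by_cases hi1 : (i : ℕ) + 1 < n + 1
      · rw [dif_pos hi1]; rw [if_pos (by omega)] at h; simpa using h
      · rw [dif_neg hi1]; rw [if_neg (by omega)] at h; simpa using h
    · rw [dif_neg hi0]
      rw [if_neg hi0] at h
      by_cases hi1 : (i : ℕ) + 1 < n + 1
      · rw [dif_pos hi1]; rw [if_pos (by omega)] at h; simpa using h
      · rw [dif_neg hi1]; rw [if_neg (by omega)] at h; simpa using h
  · have hne : i ≠ j := fun h => by simp [h] at hgt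
    rw [if_neg hne, dif_pos (by omega : (j : ℕ) + 1 < n + 1)]
    have h := adjC_row_gt (n := n) hgt (by omega)
    by_cases hj0 : (j : ℕ) = 0
    · rw [dif_pos hj0]; rw [if_pos hj0] at h; simpa using h
    · rw [dif_neg hj0]; rw [if_neg hj0] at h; simpa using h


/-! ## Identification with the adjugate -/

/-- The corner cofactor: deleting the last row and the first column of `T` leaves a lower
triangular matrix with `y` on the diagonal, so `adj(T)_{0,n} = (-1)^n y^n = (-y)^n`. [classical] -/
theorem adjugate_triT_zero_last (n : ℕ) :
    (triT n).adjugate 0 (Fin.last n) = (-X 1) ^ n := by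
  rw [Matrix.adjugate_fin_succ_eq_det_submatrix, Fin.succAbove_last, Fin.succAbove_zero,
    Fin.val_last, Fin.val_zero, add_zero]
  have hlow : ((triT n).submatrix Fin.castSucc Fin.succ).BlockTriangular OrderDual.toDual := by
    intro r c hrc
    have hrc' : r < c := hrc
    rw [Fin.lt_def] at hrc'
    simp only [Matrix.submatrix_apply, triT, Matrix.of_apply, Fin.val_castSucc, Fin.val_succ]
    rw [if_neg (by omega), if_neg (by omega), if_neg (by omega)]
  rw [Matrix.det_of_lowerTriangular _ hlow]
  have hdiag : ∀ r : Fin n, (triT n).submatrix Fin.castSucc Fin.succ r r = X 1 := by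
    intro r
    simp [Matrix.submatrix_apply, triT, Fin.val_succ]
  simp only [hdiag, Finset.prod_const, Finset.card_univ, Fintype.card_fin]
  exact (neg_pow _ _).symm

/-- `adjC n 0 n = (-y)^n`. [this file] -/
theorem adjT_zero_last (n : ℕ) : adjT n 0 (Fin.last n) = (-X 1) ^ n := by
  simp only [adjT, Matrix.of_apply, Fin.val_zero, Fin.val_last]
  rw [adjC_of_le (Nat.zero_le n), Nat.sub_zero, Nat.sub_self, tco_zero, mul_one, mul_one]

/-- `det T • adjT = θ_{n+1} • adj T` (multiply `adjT · T = θ_{n+1} · 1` by `adj T`). [this file] -/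
theorem det_smul_adjT (n : ℕ) :
    (triT n).det • adjT n = tco (n + 1) • (triT n).adjugate := by
  have h1 := adjT_mul_triT n
  have h2 : adjT n * triT n * (triT n).adjugate = tco (n + 1) • (triT n).adjugate := by
    rw [h1, Matrix.smul_mul, Matrix.one_mul]
  rw [Matrix.mul_assoc, Matrix.mul_adjugate, Matrix.mul_smul, Matrix.mul_one] at h2
  exact h2

/-- **`det T = θ_{n+1}`**: the determinant of the tridiagonal Toeplitz pencil is the continuant
(read off the corner entry of `det_smul_adjT`). [classical] -/
theorem det_triT (n : ℕ) : (triT n).det = tco (n + 1) := by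
  have h := congr_fun (congr_fun (det_smul_adjT n) 0) (Fin.last n)
  rw [Matrix.smul_apply, Matrix.smul_apply, adjT_zero_last, adjugate_triT_zero_last, smul_eq_mul,
    smul_eq_mul] at h
  exact mul_right_cancel₀ (pow_ne_zero _ (neg_ne_zero.mpr (X_ne_zero _))) h

/-- **Usmani's formula**: the adjugate of the tridiagonal Toeplitz pencil is
`adj(T)_{ij} = (-y)^{j-i} θ_i θ_{n-j}` (`i ≤ j`), `(-z)^{i-j} θ_j θ_{n-i}` (`i > j`).
[folklore; Usmani, LAA 212/213 (1994)] -/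
theorem adjugate_triT : ∀ n : ℕ, (triT n).adjugate = adjT n := by
  intro n
  have h := det_smul_adjT n
  rw [det_triT] at h
  apply Matrix.ext
  intro i j
  have hij := congr_fun (congr_fun h i) j
  rw [Matrix.smul_apply, Matrix.smul_apply, smul_eq_mul, smul_eq_mul] at hij
  exact (mul_left_cancel₀ (tco_ne_zero _) hij).symm

/-- Entries of the adjugate, natural-index form. [this file] -/
theorem adjugate_triT_apply (n : ℕ) (i j : Fin (n + 1)) :
    (triT n).adjugate i j = adjC n i j := by
  rw [adjugate_triT]; rfl

end

end Summit.ValiantsHypothesis.ValiantsHypothesis.Theorems.ValuativeFlip
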